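import Summits.BirchSwinnertonDyer.Rank1Residual.Additive.SignedTwistSelmerInfty
import HarnessLib

/-!
# The TOWER TWIST: over `K_∞ = K₀ℚ_∞` (where `η` is trivial) the transport `Θ_*` carries Kobayashi's
# PLUS Selmer group of `W` onto that of `V = W ⊗ η`, and the `χ`-component onto the `χη`-component
(cell `bsd-potss`, seat `bsd-potss-ctrl` g2; T-e2-R1⁺ piece (i), brick (i-d): the `η`-DECOMPOSITION of
`Sel⁺(V/K₀ℚ_∞)` on the `ℚ`-internal objects — its trivial part is `Θ_*` of the `η`-part of `W`, which
(D3⁺) for the SWAPPED pair identifies with `Sel⁺(V/ℚ_∞)`; TARGET.md v6 §0.12 (e) piece (i))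

HONEST FRAMING (cell `bsd-potss`, run/shared/lean/pub/bsd-potss/; FULL-BSD rank ≤ 1 programme,
tranche 1b): TOOL THEOREMS ONLY — no definition, no named Literature fact, no Summits-side fact
`def … : Prop`, no `sorry`, axioms standard; binders x1b's (`hθ`, `hc`, `hCV`, `hη`,
`[(galRange K₀).Normal]`); nothing is booked; no label / mark / count moves; nothing about (C1_η) or
`BSD(W, p)` is claimed.

## What (x1b's setting: `W`, `K₀ ∋ θ`, `θ² = c`, `θ ∉ ℚ`, `V = C • W^{(c)}`, `Θ = geomTransport`,
## `Ψ = localTransport`, `Θ_* = h1Transport` on subgroups `H ≤ Gal(ℚ̄/K₀)`; sign `ε = +1` ONLY —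
## the `m = −1` clause of `E⁻(K_{n,v})` refers to `E(ℚ_p)`, on which `Ψ` is NOT equivariant)
* `mem_localKummerOverOfEmb_iff_h1Equiv_mem` — GENERIC (any `K`, any `H ≤ Γ_K`, any `K`-field `E`,
  embedding `ι`): the Kummer condition `localKummerOverOfEmb` is transported along an `H`-equivariant
  `θ : W[p^∞] ≃ V[p^∞]` and a `Gal(Ē/L_w)`-equivariant `Ψ : W(Ē) ≃ V(Ē)` forming the local square,
  from `A` to any `B` with `P ∈ A ↔ Ψ P ∈ B` (the Kummer twin of the tree's `mem_resKer_iff_h1Equiv_mem`).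
* `localTransport_localPairTraceOfEmb` — `Ψ ∘ Tr_{H₁/H₂} = Tr_{H₁/H₂} ∘ Ψ` for `H₁ ≤ Gal(ℚ̄/K₀)`;
  `localTransport_mem_towerSigned_one_iff` — `P ∈ E⁺_W(K₀ℚ_n·E) ↔ Ψ P ∈ E⁺_V(K₀ℚ_n·E)`.
* `mem_towerSignedSelmerLayer_one_iff_h1Transport` — `d ∈ Sel⁺(W/K₀ℚ_n) ↔ Θ_* d ∈ Sel⁺(V/K₀ℚ_n)`;
  `map_h1Transport_towerSignedSelmerInfty_one` — `Θ_* (Sel⁺(W/K₀ℚ_∞)) = Sel⁺(V/K₀ℚ_∞)`;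
  **`map_h1Transport_towerSignedSelmerInftyEta_one`** — `Θ_* (Sel⁺(W/K₀ℚ_∞)^χ) = Sel⁺(V/K₀ℚ_∞)^{χη}`
  for every `χ : Γ_ℚ →* ℤˣ` (`Θ_* conj_σ = η(σ) conj_σ Θ_*`); instances `χ = η` (the `η`-part of `W`
  goes to the INVARIANT part of `V`, `η² = 1`) and `χ = 1`.

References: [Kobayashi2003] §2 p. 4 (E^±(K_{n,v})), Def. 2.1 (p. 5), §4 p. 8 (`M^η = ε_η M`);
[SerreGaloisCohomology1997] I.§2.4; [Dokchitser2013ParityNotes] §4 (the sign rule).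
-/

noncomputable section

open scoped Classical

open WeierstrassCurve Field

universe u

/-! ## §1 Generic: the Kummer condition under an isomorphism of coefficients -/

namespace Literature.NumberTheory.EllipticCurves.Kobayashi2003

open Literature.NumberTheory.EllipticCurves Literature.NumberTheory.GaloisRepresentations

section Generic

variable {K : Type u} [Field K] (W V : WeierstrassCurve K) (p : ℕ)
  (H : Subgroup (absoluteGaloisGroup K)) {E : Type u} [Field E] [Algebra K E]
  (ι : AlgebraicClosure K →ₐ[K] AlgebraicClosure E)

/-- **The Kummer condition is transported along an isomorphism of coefficients (one direction).**
Let `θ : W[p^∞] ≃ V[p^∞]` be `H`-equivariant and `Ψ : W(K̄_E) ≃ V(K̄_E)` be `Gal(K̄_E/L_w)`-equivariant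
with `ι_* ∘ θ = Ψ ∘ ι_*` on `W[p^∞]`; if `Ψ` maps `A` into `B`, then `x ∈ Kummer_W(A)` implies
`θ_* x ∈ Kummer_V(B)`: the witness `(φ, Q, k)` goes to `(θ ∘ φ, Ψ Q, k)`.
[cite: SerreGaloisCohomology1997, I.§2.4] -/
theorem h1Equiv_mem_localKummerOverOfEmb_of_mem
    (θ : W.geomPrimaryTorsion p ≃+ V.geomPrimaryTorsion p) (hθ : ∀ (g : H) m, θ (g • m) = g • θ m)
    (Ψ : localPoints W E ≃+ localPoints V E)
    (hΨ : ∀ (τ : localSubgroupOfEmb H ι) (P : localPoints W E), Ψ (τ • P) = τ • Ψ P)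
    (hsq : ∀ m : W.geomPrimaryTorsion p,
      pointsMapOfEmb V ι ((θ m : V.geomPrimaryTorsion p) : V.geomPoints) =
        Ψ (pointsMapOfEmb W ι ((m : W.geomPrimaryTorsion p) : W.geomPoints)))
    {A : AddSubgroup (localPoints W E)} {B : AddSubgroup (localPoints V E)}
    (hAB : ∀ P ∈ A, Ψ P ∈ B) {x : W.subgroupH1 p H} (hx : x ∈ localKummerOverOfEmb W p H ι A) :
    h1Equiv (G := H) θ hθ x ∈ localKummerOverOfEmb V p H ι B := by
  obtain ⟨φ, Q, k, hxφ, hP, hφ⟩ := hx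
  refine ⟨contOneCocycles.push (θ : W.geomPrimaryTorsion p →+ V.geomPrimaryTorsion p) hθ φ, Ψ Q, k,
    ?_, ?_, fun τ ↦ ?_⟩
  · rw [← hxφ, h1Equiv_apply, Literature.NumberTheory.EllipticCurves.resH1Hom_id_oneCocycleClass]
  · rw [← map_nsmul]
    exact hAB _ hP
  · rw [contOneCocycles.push_apply, AddMonoidHom.coe_coe, hsq, hφ τ, map_sub]
    change Ψ ((τ : absoluteGaloisGroup E) • Q) - Ψ Q = _
    rw [show (τ : absoluteGaloisGroup E) • Q = τ • Q from rfl, hΨ]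
    rfl

/-- **The Kummer condition under an isomorphism of coefficients (both directions)**: with `θ`, `Ψ`
as above and `P ∈ A ↔ Ψ P ∈ B`, `x ∈ Kummer_W(A) ↔ θ_* x ∈ Kummer_V(B)` (apply the one-directional
statement to `(θ, Ψ)` and to `(θ⁻¹, Ψ⁻¹)`). The Kummer twin of the tree's `mem_resKer_iff_h1Equiv_mem`.
[cite: SerreGaloisCohomology1997, I.§2.4] -/
theorem mem_localKummerOverOfEmb_iff_h1Equiv_mem
    (θ : W.geomPrimaryTorsion p ≃+ V.geomPrimaryTorsion p) (hθ : ∀ (g : H) m, θ (g • m) = g • θ m)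
    (Ψ : localPoints W E ≃+ localPoints V E)
    (hΨ : ∀ (τ : localSubgroupOfEmb H ι) (P : localPoints W E), Ψ (τ • P) = τ • Ψ P)
    (hsq : ∀ m : W.geomPrimaryTorsion p,
      pointsMapOfEmb V ι ((θ m : V.geomPrimaryTorsion p) : V.geomPoints) =
        Ψ (pointsMapOfEmb W ι ((m : W.geomPrimaryTorsion p) : W.geomPoints)))
    {A : AddSubgroup (localPoints W E)} {B : AddSubgroup (localPoints V E)}
    (hAB : ∀ P, P ∈ A ↔ Ψ P ∈ B) (x : W.subgroupH1 p H) :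
    x ∈ localKummerOverOfEmb W p H ι A ↔ h1Equiv (G := H) θ hθ x ∈ localKummerOverOfEmb V p H ι B := by
  refine ⟨h1Equiv_mem_localKummerOverOfEmb_of_mem W V p H ι θ hθ Ψ hΨ hsq (fun P hP ↦ (hAB P).mp hP),
    fun h ↦ ?_⟩
  have hθ' : ∀ (g : H) m, θ.symm (g • m) = g • θ.symm m := symm_equivariant (G := H) θ hθ
  have hΨ' : ∀ (τ : localSubgroupOfEmb H ι) (P : localPoints V E), Ψ.symm (τ • P) = τ • Ψ.symm P :=
    fun τ P ↦ by
      apply Ψ.injective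
      rw [AddEquiv.apply_symm_apply, hΨ, AddEquiv.apply_symm_apply]
  have hsq' : ∀ m : V.geomPrimaryTorsion p,
      pointsMapOfEmb W ι ((θ.symm m : W.geomPrimaryTorsion p) : W.geomPoints) =
        Ψ.symm (pointsMapOfEmb V ι ((m : V.geomPrimaryTorsion p) : V.geomPoints)) := fun m ↦ by
    rw [AddEquiv.eq_symm_apply, ← hsq, AddEquiv.apply_symm_apply]
  have h' := h1Equiv_mem_localKummerOverOfEmb_of_mem V W p H ι θ.symm hθ' Ψ.symm hΨ' hsq'
    (A := B) (B := A) (fun P hP ↦ by rw [hAB, AddEquiv.apply_symm_apply]; exact hP) h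
  have e : h1Equiv (G := H) θ.symm hθ' (h1Equiv (G := H) θ hθ x) = x :=
    (h1Equiv (G := H) θ hθ).symm_apply_apply x
  rwa [e] at h'

end Generic

end Literature.NumberTheory.EllipticCurves.Kobayashi2003

namespace Summit.BirchSwinnertonDyer.Rank1Residual.Additive.SignedTwist

open Literature.NumberTheory.EllipticCurves Literature.NumberTheory.GaloisRepresentations
  Literature.NumberTheory.EllipticCurves.Kobayashi2003
  Summit.BirchSwinnertonDyer.Rank1Residual.AdditivePotMult ZpExtension

/-! ## §2 `Ψ` and the PLUS tower groups -/

section Local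

variable (W : WeierstrassCurve ℚ) (K₀ : Type) [Field K₀] [NumberField K₀] {θ : K₀} {c : ℚ}
  (hθ : θ ∉ Set.range (algebraMap ℚ K₀)) (hc : θ ^ 2 = algebraMap ℚ K₀ c)
  {p : ℕ} [Fact p.Prime] (κ : ZpExtension ℚ p)
  {V : WeierstrassCurve ℚ} {C : VariableChange ℚ} (hCV : C • W.quadraticTwist c = V)
  {E : Type} [Field E] [Algebra ℚ E] (ι : AlgebraicClosure ℚ →ₐ[ℚ] AlgebraicClosure E)

/-- **`Ψ` commutes with the pair trace `Tr_{H₁/H₂}` whenever `H₁ ≤ Gal(ℚ̄/K₀)`** (the trace is a sum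
over representatives in `Gal(ℚ̄_E/·) ∩ res⁻¹ H₁`, on which `Ψ` is equivariant).
[cite: Kobayashi2003, §2 p. 4 (the trace maps)] -/
theorem localTransport_localPairTraceOfEmb {H₁ : Subgroup (absoluteGaloisGroup ℚ)}
    (hH₁ : H₁ ≤ galRange (K := ℚ) K₀) (H₂ : Subgroup (absoluteGaloisGroup ℚ)) [H₂.FiniteIndex]
    (P : localPoints W E) :
    localTransport W K₀ hθ hc hCV E ι (localPairTraceOfEmb ι W H₁ H₂ P) =
      localPairTraceOfEmb ι V H₁ H₂ (localTransport W K₀ hθ hc hCV E ι P) := by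
  classical
  haveI : Fintype (localSubgroupOfEmb H₁ ι ⧸
      (localSubgroupOfEmb H₂ ι).subgroupOf (localSubgroupOfEmb H₁ ι)) := Fintype.ofFinite _
  rw [localPairTraceOfEmb_apply, localPairTraceOfEmb_apply, map_sum]
  refine Finset.sum_congr rfl fun q _ ↦ ?_
  exact localTransport_smul_of_mem W K₀ hθ hc hCV E ι hH₁ _ P

/-- **`P ∈ E⁺_W(K₀ℚ_n·E) ↔ Ψ P ∈ E⁺_V(K₀ℚ_n·E)`** (Kobayashi's PLUS tower group, §2 p. 4, both
curves): fixed points under subgroups of `Gal(ℚ̄/K₀)` and tower traces correspond under `Ψ`; the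
plus side has no `m = −1` clause. [cite: Kobayashi2003, §2 p. 4 (E⁺(K_{n,v}))] -/
theorem localTransport_mem_towerSigned_one_iff (n : ℕ) (P : localPoints W E) :
    P ∈ towerSignedLocalPointsOfEmb (towerSubgroup κ K₀) ι W 1 n ↔
      localTransport W K₀ hθ hc hCV E ι P ∈
        towerSignedLocalPointsOfEmb (towerSubgroup κ K₀) ι V 1 n := by
  have h1 : (1 : ℤˣ) ≠ -1 := by decide
  have hfix : ∀ (m : ℕ) (R : localPoints W E),
      R ∈ localFixedPointsOfEmb ι W (towerSubgroup κ K₀ m) ↔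
        localTransport W K₀ hθ hc hCV E ι R ∈ localFixedPointsOfEmb ι V (towerSubgroup κ K₀ m) :=
    fun m R ↦ ⟨localTransport_mem_localFixedPointsOfEmb W K₀ hθ hc hCV ι
        (towerSubgroup_le_galRange κ K₀ m),
      fun h ↦ by
        have h' := localTransport_symm_mem_localFixedPointsOfEmb W K₀ hθ hc hCV ι
          (towerSubgroup_le_galRange κ K₀ m) h
        rwa [AddEquiv.symm_apply_apply] at h'⟩
  rw [mem_towerSignedLocalPointsOfEmb_iff, mem_towerSignedLocalPointsOfEmb_iff]
  constructor
  · rintro ⟨hP, htr, -⟩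
    refine ⟨(hfix n P).mp hP, fun m hm hε ↦ ?_, fun h ↦ absurd h h1⟩
    rw [← localTransport_localPairTraceOfEmb W K₀ hθ hc hCV ι (towerSubgroup_le_galRange κ K₀ (m + 1))]
    exact (hfix m _).mp (htr m hm hε)
  · rintro ⟨hP, htr, -⟩
    refine ⟨(hfix n P).mpr hP, fun m hm hε ↦ ?_, fun h ↦ absurd h h1⟩
    rw [hfix m, localTransport_localPairTraceOfEmb W K₀ hθ hc hCV ι
      (towerSubgroup_le_galRange κ K₀ (m + 1))]
    exact htr m hm hε

end Local

/-! ## §3 `Θ_*` and the PLUS tower Selmer groups -/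

section Selmer

variable (W : WeierstrassCurve ℚ) (K₀ : Type) [Field K₀] [NumberField K₀] {θ : K₀} {c : ℚ}
  (hθ : θ ∉ Set.range (algebraMap ℚ K₀)) (hc : θ ^ 2 = algebraMap ℚ K₀ c)
  (p : ℕ) [Fact p.Prime] (κ : ZpExtension ℚ p)
  {V : WeierstrassCurve ℚ} {C : VariableChange ℚ} (hCV : C • W.quadraticTwist c = V)
  (E : Type) [Field E] [Algebra ℚ E]
  (η : absoluteGaloisGroup ℚ →* ℤˣ)
  (hη : ∀ σ : absoluteGaloisGroup ℚ, η σ = 1 ↔ σ • rootInClosure K₀ θ = rootInClosure K₀ θ)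

/-- The PLUS tower Kummer condition at the chosen embedding transports under `Θ_*`.
[cite: Kobayashi2003, Def. 2.1 (p. 5)] -/
theorem mem_localKummerOverOfEmb_towerSigned_one_iff_h1Transport (n : ℕ)
    (x : W.subgroupH1 p (towerSubgroup κ K₀ n)) :
    x ∈ localKummerOverOfEmb W p (towerSubgroup κ K₀ n) (closureEmb (K := ℚ) E)
        (towerSignedLocalPointsOfEmb (towerSubgroup κ K₀) (closureEmb (K := ℚ) E) W 1 n) ↔
      h1Transport W K₀ hθ hc p hCV (towerSubgroup κ K₀ n) (towerSubgroup_le_galRange κ K₀ n) x ∈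
        localKummerOverOfEmb V p (towerSubgroup κ K₀ n) (closureEmb (K := ℚ) E)
          (towerSignedLocalPointsOfEmb (towerSubgroup κ K₀) (closureEmb (K := ℚ) E) V 1 n) :=
  mem_localKummerOverOfEmb_iff_h1Equiv_mem W V p (towerSubgroup κ K₀ n) (closureEmb (K := ℚ) E)
    (geomTransport W K₀ hθ hc p hCV)
    (geomTransport_smul_of_le W K₀ hθ hc p hCV (towerSubgroup_le_galRange κ K₀ n))
    (localTransport W K₀ hθ hc hCV E (closureEmb (K := ℚ) E))
    (fun τ P ↦ localTransport_smul_of_mem W K₀ hθ hc hCV E (closureEmb (K := ℚ) E)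
      (towerSubgroup_le_galRange κ K₀ n) τ P)
    (fun m ↦ pointsMap_geomTransport W K₀ hθ hc p hCV E m)
    (fun P ↦ localTransport_mem_towerSigned_one_iff W K₀ hθ hc κ hCV (closureEmb (K := ℚ) E) n P) x

include hη in
/-- **`d ∈ Sel⁺(W/K₀ℚ_n) ↔ Θ_* d ∈ Sel⁺(V/K₀ℚ_n)`**: classical part by x1b's
`mem_selmerGroupOver_iff_h1Transport`, the plus condition at every conjugate `σ` by §1/§2 (the signs
`η(σ)` of `Θ_* conj_σ = η(σ) conj_σ Θ_*` are invisible to membership).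
[cite: Kobayashi2003, Def. 2.1 (p. 5)] [cite: Dokchitser2013ParityNotes, §4] -/
theorem mem_towerSignedSelmerLayer_one_iff_h1Transport [(galRange (K := ℚ) K₀).Normal] (n : ℕ)
    (x : W.subgroupH1 p (towerSubgroup κ K₀ n)) :
    x ∈ towerSignedSelmerLayer W κ K₀ E 1 n ↔
      h1Transport W K₀ hθ hc p hCV (towerSubgroup κ K₀ n) (towerSubgroup_le_galRange κ K₀ n) x ∈
        towerSignedSelmerLayer V κ K₀ E 1 n := by
  have hUn := towerSubgroup_le_galRange κ K₀ n
  have hsign : ∀ (σ : absoluteGaloisGroup ℚ) (S : AddSubgroup (V.subgroupH1 p (towerSubgroup κ K₀ n))),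
      h1Transport W K₀ hθ hc p hCV _ hUn (W.conjH1 p (towerSubgroup κ K₀ n) σ x) ∈ S ↔
        V.conjH1 p (towerSubgroup κ K₀ n) σ (h1Transport W K₀ hθ hc p hCV _ hUn x) ∈ S := by
    intro σ S
    rw [h1Transport_conjH1 W K₀ hθ hc p hCV η hη]
    rcases Int.units_eq_one_or (η σ) with h | h
    · rw [h, Units.val_one, one_zsmul]
    · rw [h, Units.val_neg, Units.val_one, neg_one_zsmul, neg_mem_iff]
  rw [Additive.mem_towerSignedSelmerLayer_iff, Additive.mem_towerSignedSelmerLayer_iff,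
    mem_selmerGroupOver_iff_h1Transport W K₀ hθ hc p hCV η hη (towerSubgroup κ K₀ n) hUn]
  refine and_congr Iff.rfl (forall_congr' fun σ ↦ ?_)
  rw [← hsign, mem_localKummerOverOfEmb_towerSigned_one_iff_h1Transport W K₀ hθ hc p κ hCV E n]

include hη in
/-- **`Θ_* (Sel⁺(W/K₀ℚ_∞)) = Sel⁺(V/K₀ℚ_∞)`** (the union over `n` of the restricted layer groups;
`Θ_*` commutes with restriction, `h1Transport_resOfLe`, and is bijective at every layer).
[cite: Kobayashi2003, Def. 2.1 (p. 5)] -/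
theorem map_h1Transport_towerSignedSelmerInfty_one [(galRange (K := ℚ) K₀).Normal] :
    (towerSignedSelmerInfty W κ K₀ E 1).map
        (h1Transport W K₀ hθ hc p hCV (towerTopSubgroup κ K₀) inf_le_right :
          W.subgroupH1 p (towerTopSubgroup κ K₀) →+ V.subgroupH1 p (towerTopSubgroup κ K₀)) =
      towerSignedSelmerInfty V κ K₀ E 1 := by
  have key : ∀ n (d : W.subgroupH1 p (towerSubgroup κ K₀ n)),
      h1Transport W K₀ hθ hc p hCV (towerTopSubgroup κ K₀) inf_le_right
          (W.resOfLe p (towerTopSubgroup_le κ K₀ n) d) =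
        V.resOfLe p (towerTopSubgroup_le κ K₀ n)
          (h1Transport W K₀ hθ hc p hCV (towerSubgroup κ K₀ n) (towerSubgroup_le_galRange κ K₀ n) d) :=
    fun n d ↦ h1Transport_resOfLe W K₀ hθ hc p hCV (towerTopSubgroup_le κ K₀ n) inf_le_right
      (towerSubgroup_le_galRange κ K₀ n) d
  apply le_antisymm
  · rw [AddSubgroup.map_le_iff_le_comap]
    refine (iSup_le fun n ↦ ?_ : (⨆ n : ℕ, (towerSignedSelmerLayer W κ K₀ E 1 n).map
      (W.resOfLe p (towerTopSubgroup_le κ K₀ n))) ≤ _)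
    rintro _ ⟨d, hd, rfl⟩
    rw [AddSubgroup.mem_comap, AddMonoidHom.coe_coe, key]
    exact map_resOfLe_towerSignedSelmerLayer_le V κ K₀ E 1 n
      ⟨_, (mem_towerSignedSelmerLayer_one_iff_h1Transport W K₀ hθ hc p κ hCV E η hη n d).mp hd, rfl⟩
  · refine (iSup_le fun n ↦ ?_ : (⨆ n : ℕ, (towerSignedSelmerLayer V κ K₀ E 1 n).map
      (V.resOfLe p (towerTopSubgroup_le κ K₀ n))) ≤ _)
    rintro _ ⟨d', hd', rfl⟩
    obtain ⟨d, rfl⟩ : ∃ d, h1Transport W K₀ hθ hc p hCV (towerSubgroup κ K₀ n)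
        (towerSubgroup_le_galRange κ K₀ n) d = d' := ⟨_, AddEquiv.apply_symm_apply _ d'⟩
    refine ⟨W.resOfLe p (towerTopSubgroup_le κ K₀ n) d,
      map_resOfLe_towerSignedSelmerLayer_le W κ K₀ E 1 n
        ⟨d, (mem_towerSignedSelmerLayer_one_iff_h1Transport W K₀ hθ hc p κ hCV E η hη n d).mpr hd',
          rfl⟩, ?_⟩
    rw [AddMonoidHom.coe_coe, key]

include hη in
/-- **THE TOWER TWIST on components: `Θ_* (Sel⁺(W/K₀ℚ_∞)^χ) = Sel⁺(V/K₀ℚ_∞)^{χη}`** for every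
character `χ : Γ_ℚ → {±1}` — `Θ_* conj_σ = η(σ) conj_σ Θ_*`, so a `χ`-eigenclass goes to a
`χη`-eigenclass. [cite: Kobayashi2003, §4 p. 8 (M^η = ε_η M)] [cite: Dokchitser2013ParityNotes, §4] -/
theorem map_h1Transport_towerSignedSelmerInftyEta_one [(galRange (K := ℚ) K₀).Normal]
    (χ : absoluteGaloisGroup ℚ →* ℤˣ) :
    (towerSignedSelmerInftyEta W κ K₀ E χ 1).map
        (h1Transport W K₀ hθ hc p hCV (towerTopSubgroup κ K₀) inf_le_right :
          W.subgroupH1 p (towerTopSubgroup κ K₀) →+ V.subgroupH1 p (towerTopSubgroup κ K₀)) =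
      towerSignedSelmerInftyEta V κ K₀ E (χ * η) 1 := by
  have hsel := map_h1Transport_towerSignedSelmerInfty_one W K₀ hθ hc p κ hCV E η hη
  have hconj : ∀ (σ : absoluteGaloisGroup ℚ) (s : W.subgroupH1 p (towerTopSubgroup κ K₀)),
      V.conjH1 p (towerTopSubgroup κ K₀) σ
          (h1Transport W K₀ hθ hc p hCV (towerTopSubgroup κ K₀) inf_le_right s) =
        ((η σ : ℤˣ) : ℤ) • h1Transport W K₀ hθ hc p hCV (towerTopSubgroup κ K₀) inf_le_right
          (W.conjH1 p (towerTopSubgroup κ K₀) σ s) := fun σ s ↦ by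
    rw [h1Transport_conjH1 W K₀ hθ hc p hCV η hη, units_smul_units_smul]
  ext t
  constructor
  · rintro ⟨s, ⟨hs, heig⟩, rfl⟩
    refine ⟨hsel ▸ ⟨s, hs, rfl⟩, fun σ hσ ↦ ?_⟩
    rw [AddMonoidHom.coe_coe, hconj, heig σ hσ, map_zsmul, smul_smul, MonoidHom.mul_apply,
      Units.val_mul, mul_comm]
  · rintro ⟨ht, heig⟩
    obtain ⟨s, hs, rfl⟩ : t ∈ (towerSignedSelmerInfty W κ K₀ E 1).map
        (h1Transport W K₀ hθ hc p hCV (towerTopSubgroup κ K₀) inf_le_right :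
          W.subgroupH1 p (towerTopSubgroup κ K₀) →+ V.subgroupH1 p (towerTopSubgroup κ K₀)) :=
      hsel ▸ ht
    refine ⟨s, ⟨hs, fun σ hσ ↦ ?_⟩, rfl⟩
    have h := heig σ hσ
    rw [AddMonoidHom.coe_coe] at h
    have h2 : h1Transport W K₀ hθ hc p hCV (towerTopSubgroup κ K₀) inf_le_right
          (W.conjH1 p (towerTopSubgroup κ K₀) σ s) =
        ((η σ : ℤˣ) : ℤ) • V.conjH1 p (towerTopSubgroup κ K₀) σ
          (h1Transport W K₀ hθ hc p hCV (towerTopSubgroup κ K₀) inf_le_right s) := by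
      rw [hconj, units_smul_units_smul]
    apply (h1Transport W K₀ hθ hc p hCV (towerTopSubgroup κ K₀) inf_le_right).injective
    rw [map_zsmul, h2, h, smul_smul, MonoidHom.mul_apply, Units.val_mul, mul_left_comm,
      ← Units.val_mul, Int.units_mul_self, Units.val_one, mul_one]

end Selmer

end Summit.BirchSwinnertonDyer.Rank1Residual.Additive.SignedTwist

end
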